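import Summits.CriticalPhenomena.SAWScalingLimit.Theorems.IsingBoundaryRatio.Negative.IsingBoundaryRatioLattice
import Literature.Probability.LatticeModels.RandomClusterProofs
import Literature.Probability.LatticeModels.IsingTransport
import HarnessLib

/-!
# Crux `IsingBoundaryRatio` (stmt-CriticalPhenomena-10650), line `fk-anchor-transfer`:
Edwards–Sokal form of the crux's normal-form two-point function

The crux's free critical Ising two-point function `T Ω δ x y = ⟨σ_xσ_y⟩^free_{Ω_δ, β_c}`
(`Negative.T`, volume `meshDomainFinset Ω δ` of the graph `discreteDomainGraph Ω δ` on `Site 2`)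
equals the FK–Ising (random-cluster, `q = 2`, `p = 1 - e^{-2β_c}`, free boundary conditions)
connection probability `φ⁰_{Ω_δ}[x ↔ y]` of the finite graph `domainSubgraph Ω δ` on the vertex type
`↥(meshDomain Ω δ)` (Edwards–Sokal coupling; Grimmett 2006, Thm 1.16). This is step (a) of the
intended lattice proof of `stub_anchorLocality` (arm-origin forgetting for critical FK–Ising), recorded
in `Cruxes/IsingBoundaryRatio/Lines/fk_anchor_transfer.stuck.md`: it puts the open stub in percolation
language, where the tree's FK tools (`rcMeasure_fkg_holds`, `RandomClusterDomainMarkov*`,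
`fkIsing_rsw_holds`) apply.

Proof: transport of free expectations along the embedding `Subtype.val : ↥(meshDomain Ω δ) ↪ Site 2`
(`isingTwoPoint_free_map`; `domainSubgraph` is the pulled-back graph by definition and
`meshDomainFinset = univ.map val`), then the tree's finite-graph Edwards–Sokal identity
`edwardsSokal_twoPoint_holds`.
-/

noncomputable section

open scoped Classical
open MeasureTheory Filter Set Function
open Literature.Probability.LatticeModels Literature.Probability.RandomPlanarGeometry

namespace Summit.CriticalPhenomena.SAWScalingLimit.Theorems.IsingBoundaryRatio

open Summit.CriticalPhenomena.SAWScalingLimit.Theorems.IsingBoundaryRatio.Negative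

/-- `meshDomainFinset Ω δ` is the image of `univ : Finset ↥(meshDomain Ω δ)` under the inclusion,
for a bounded domain and a positive mesh. -/
theorem meshDomainFinset_eq_univ_map {Ω : Set ℂ} {δ : ℝ} (hΩ : Bornology.IsBounded Ω) (hδ : 0 < δ)
    [Fintype (meshDomain Ω δ)] :
    meshDomainFinset Ω δ = (Finset.univ : Finset (meshDomain Ω δ)).map (Embedding.subtype _) := by
  ext z
  rw [← Finset.mem_coe, coe_meshDomainFinset hΩ hδ]
  simp

/-- **Edwards–Sokal for the crux's normal form** (registered sub-goal `stub_T_eq_fkConn` of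
stmt-CriticalPhenomena-10650): for a bounded domain `Ω`, a mesh `δ > 0`, any `Fintype` structure on
`↥(meshDomain Ω δ)` and sites `x, y ∈ meshDomain Ω δ`,
`T Ω δ x y = φ^{free}_{domainSubgraph Ω δ, 1 - e^{-2β_c}, 2}[x ↔ y]`. -/
theorem stub_T_eq_fkConn :
    ∀ (Ω : Set ℂ) (δ : ℝ) [Fintype (meshDomain Ω δ)], Bornology.IsBounded Ω → 0 < δ →
      ∀ (x y : Site 2) (hx : x ∈ meshDomain Ω δ) (hy : y ∈ meshDomain Ω δ),
        T Ω δ x y = (rcMeasure (domainSubgraph Ω δ) (1 - Real.exp (-2 * criticalBetaTwo)) 2 ∅).real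
          (Literature.Probability.Percolation.openConn (⟨x, hx⟩ : meshDomain Ω δ) ⟨y, hy⟩) := by
  intro Ω δ _ hΩ hδ x y hx hy
  have hES := edwardsSokal_twoPoint_holds (domainSubgraph Ω δ) criticalBetaTwo_pos.le
    (⟨x, hx⟩ : meshDomain Ω δ) ⟨y, hy⟩
  rw [← hES]
  have hmap := isingTwoPoint_free_map (G := domainSubgraph Ω δ) (G' := discreteDomainGraph Ω δ)
    (Embedding.subtype (· ∈ meshDomain Ω δ)) (Λ := (Finset.univ : Finset (meshDomain Ω δ)))
    (fun a _ b _ => by simp [domainSubgraph, SimpleGraph.comap_adj]) criticalBetaTwo 0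
    (⟨x, hx⟩ : meshDomain Ω δ) ⟨y, hy⟩
  rw [← meshDomainFinset_eq_univ_map hΩ hδ] at hmap
  simpa [T] using hmap

end Summit.CriticalPhenomena.SAWScalingLimit.Theorems.IsingBoundaryRatio

end
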